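import Literature.NumberTheory.Automorphic.Liu2021.LocalNormClassFlip
import Literature.NumberTheory.Automorphic.Liu2021.Def412AdmissibleIffParity
import Literature.NumberTheory.QuadraticForms.PrescribedNormClassesCM
import Literature.NumberTheory.GelbartRogawski1991.UnitaryDualPairThetaKernelCM
import HarnessLib

/-!
# F0 · P5 pay-down line `Cruxes/HLiu418/Lines/F0_P5_CurveThetaLettersPaydown`: the ARITHMETIC stub R1
# `stub_arith_relabelUnit : RelabelUnit₂` PROVED (by its exact text)

Cell `hodgecm-mathlib`, floor 0, programme P5 (Alb-CM); crux item `stmt-HodgeConjecture-24832`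
(`Summit.HodgeConjecture.HodgeConjecture.Theses.HCCMUnconditional.HLiu418`).  Registered pay-down line of the two curve-theta
letters #73 ∕ #74: `Cruxes/HLiu418/Lines/F0_P5_CurveThetaLettersPaydown.lean` (F0P5-plan (g4)), five stubs G1, G2, R2, R1, A;
its glue `curveThetaHodgeTypeNecessity_hol_of : G2 → R2 → R1 → A → #74` is proved in the line.

THIS FILE closes the stub **R1** — the RELABELLING UNIT of [Liu2021, App. D Lem. D.1 (4)] («`ε′ = ε` (resp. `ε′ ≠ ε`) when `V`
is isotropic (resp. anisotropic)», `n = 2`) realised by a GLOBAL element: `stub_arith_relabelUnit_holds` states the body of the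
line's `def RelabelUnit₂ : Prop` (:233–244) TOKEN FOR TOKEN (a `Theorems/` file may not import `Cruxes.*` workfiles), so that the
line's next edition reads `theorem stub_arith_relabelUnit : RelabelUnit₂ := F0P5PaydownStubRelabelUnit.stub_arith_relabelUnit_holds`.

STATEMENT IN WORDS.  `L` a CM field, `L⁺` its maximal real subfield, `δ_L` the tree's purely imaginary unit (`imagUnit L`,
`d := δ_L² = imagUnitSq L ∈ L⁺`), `dV : Fin 2 → L` conjugation-fixed and non-zero (the registered binary hermitian frame `diag dV`;
the signature clauses at `ι` ∕ `τ′ ≠ ι` and `4 ≤ [L:ℚ]` are carried but not used).  For every `a ∈ (L⁺)ˣ` there is `a′ ∈ (L⁺)ˣ`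
whose local norm classes `locF a′ v ∈ L⁺_vˣ ⧸ N(L_vˣ)` ([Liu2021, Def. 4.11] carrier `Def411WeilCarriers.Eps`) agree with those of
`a` EXACTLY at the finite places `v` of `L⁺` where the hermitian plane `(L_v², diag dV ⊗ 1)` is isotropic
(`LemD1.IsIsotropic (LemD1OfPlace.standingData …)`).

PROOF ([Omeara1963, §71 Thm. 71:19] with the real places as parity valve; every input is a ★ theorem of the tree).
(1) The anisotropic set `T` is finite (★ `LemD1OfPlace.finite_setOf_not_isIsotropic`, Hilbert reciprocity 71:18 for `(d, −dV₀dV₁)`)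
and `d` is a non-square in `L⁺_v` for `v ∈ T` (★ `RemD5.not_isSquare_of_not_isIsotropic`), so the local norm-class group there
has two elements and a collection `ρ` with `ρ_v = 1` off `T`, `ρ_v ≠ 1` on `T` exists (★ `RemD5.exists_eps_flip` at `ε := 1`).
(2) `{v | ρ_v ≠ 1} ⊆ T` is finite and `d` is negative at every (real) place of the totally real `L⁺`
(★ `embedding_of_isReal_lt_zero_of_coe_eq_mul_self`), so ★ `QuadraticForms.exists_prescribed_normClass_of_finite` (71:19 ∕ 71:19a,
the free real signs absorbing the parity) gives `θ ∈ (L⁺)ˣ` with `locF θ = ρ`.  (3) `a′ := a·θ`: `locF` is multiplicative, so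
`locF a′ v = locF a v ↔ ρ_v = 1 ↔ v ∉ T`.  One theorem, no `def`, no named fact, no `sorry`.

HONEST LABEL: HC_CM is proved only modulo the printed citations — the 2 remaining named inputs (hLiu418, h413) — until rung 0
closes; this file closes ONE registered arithmetic stub of ONE floor-0 pay-down line and discharges no letter by itself.

## References
* [Liu2021] Y. Liu, *Fourier–Jacobi cycles and arithmetic relative trace formula*, Camb. J. Math. 9 (2021) = arXiv:2102.11518:
  App. D Lem. D.1 (4) (l. 5235), Def. 4.11–4.12 (l. 2083–2108).
* [Omeara1963] O. T. O'Meara, *Introduction to Quadratic Forms* (1963): §63B Cor. 63:13a, §71 Thm. 71:18, Thm. 71:19, Cor. 71:19a.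
* Tree: ★ `Liu2021.LocalNormClassFlip` (§1–2), ★ `Liu2021.LemD1BinaryIsotropyOfPlace`, ★ `Liu2021.Def412AdmissibleIffParity`
  (`embedding_of_isReal_lt_zero_of_coe_eq_mul_self`, `ne_zero_of_coe_eq_mul_self`), ★ `QuadraticForms.PrescribedNormClassesCM`,
  ★ `Liu2021.Def411WeilCarriers` (`locF`, `locF_apply`), ★ `GelbartRogawski1991.UnitaryDualPairThetaKernelCM` (`imagUnit*`).
-/

set_option autoImplicit false

-- the mandated namespace has the single-problem summit's repeated segment (`HodgeConjecture.HodgeConjecture`)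
set_option linter.dupNamespace false

noncomputable section

open NumberField NumberField.InfinitePlace IsDedekindDomain
open scoped Matrix ComplexOrder
open Literature.NumberTheory.Automorphic Literature.NumberTheory.Automorphic.UnitaryGroup
open Literature.NumberTheory.Automorphic.Liu2021 Literature.NumberTheory.Automorphic.Liu2021.Def411WeilCarriers
open Literature.NumberTheory.GelbartRogawski1991 Literature.NumberTheory.GelbartRogawski1991.UnitaryDualPair

namespace Summit.HodgeConjecture.HodgeConjecture.Cruxes.HLiu418.F0P5PaydownStubRelabelUnit

/-- **`stub_arith_relabelUnit` holds** — THE TYPE OF `RelabelUnit₂` (line `F0_P5_CurveThetaLettersPaydown` :233–244), token for token: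
for the registered frame `diag dV` and every `a ∈ (L⁺)ˣ` there is `a′ ∈ (L⁺)ˣ` whose local norm classes agree with those of `a` exactly
at the finite places where `(L_v², diag dV ⊗ 1)` is isotropic (the relabelling unit of [Liu2021, Lem. D.1 (4)], realised globally by
[Omeara1963, 71:19]: flip the trivial collection on the finite anisotropic set, realise it by a global `θ` with free real signs, `a′ := a·θ`).
[cite: Omeara1963, §71 Thm. 71:19, Cor. 71:19a; §63B Cor. 63:13a] [cite: Liu2021, App. D Lem. D.1 (4) (l. 5235); Def. 4.12 (l. 2102–2108)] -/
theorem stub_arith_relabelUnit_holds :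
    ∀ (L : Type) [Field L] [NumberField L] [IsCMField L] (ι : L →+* ℂ)
    (dV : Fin 2 → L) (hdV : ∀ i, IsCMField.complexConj L (dV i) = dV i) (hdV0 : ∀ i, dV i ≠ 0),
    (∃ T : GL (Fin 2) ℂ, formCongr (starRingEnd ℂ) T ((Matrix.diagonal dV).map ι) = Matrix.diagonal ![(1 : ℂ), -1]) →
    (∀ τ' : L →+* ℂ, InfinitePlace.mk τ' ≠ InfinitePlace.mk ι → ((Matrix.diagonal dV).map τ').PosDef) →
    4 ≤ Module.finrank ℚ L →
    ∀ a : (↥(maximalRealSubfield L))ˣ, ∃ a' : (↥(maximalRealSubfield L))ˣ,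
      ∀ (hJh : ((Matrix.diagonal dV).map (IsCMField.complexConj L))ᵀ = Matrix.diagonal dV) (hJdet : (Matrix.diagonal dV).det ≠ 0)
          (v : HeightOneSpectrum (𝓞 ↥(maximalRealSubfield L))),
        locF (↥(maximalRealSubfield L)) (imagUnitSq L) a' v = locF (↥(maximalRealSubfield L)) (imagUnitSq L) a v ↔
          LemD1.IsIsotropic (LemD1OfPlace.standingData L v (IsCMField.complexConj L) 2 (Matrix.diagonal dV)
            (complexConj_imagUnit L) (imagUnit_ne_zero L) le_rfl hJh hJdet) := by
  intro L _ _ _ ι dV hdV hdV0 _hsig _hdef _h4 a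
  -- the frame is hermitian with non-zero determinant (the two proof arguments of the standing data)
  have hJh₀ : ((Matrix.diagonal dV).map (IsCMField.complexConj L))ᵀ = Matrix.diagonal dV := by
    rw [Matrix.diagonal_map (map_zero _), Matrix.diagonal_transpose]
    exact congrArg Matrix.diagonal (funext hdV)
  have hJdet₀ : (Matrix.diagonal dV).det ≠ 0 := by
    rw [Matrix.det_diagonal]
    exact Finset.prod_ne_zero_iff.2 fun i _ => hdV0 i
  -- the real diagonal `t` with `diag dV = diag t ⊗ 1`, and `d = δ_L²`
  let t : Fin 2 → maximalRealSubfield L := fun i => ⟨dV i, (IsCMField.complexConj_eq_self_iff (K := L) (dV i)).1 (hdV i)⟩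
  have hJ : Matrix.diagonal dV = (Matrix.diagonal t).map (algebraMap (maximalRealSubfield L) L) := by
    rw [Matrix.diagonal_map (map_zero _)]; rfl
  have ht : ∀ i, t i ≠ 0 := fun i h => hdV0 i (congrArg Subtype.val h)
  have hd : imagUnit L * imagUnit L = algebraMap (maximalRealSubfield L) L (imagUnitSq L) := imagUnit_mul_self L
  -- (1) the anisotropic set `T`: finite, and `d` is a non-square there
  set T : Set (HeightOneSpectrum (𝓞 (maximalRealSubfield L))) := {v | ¬ LemD1.IsIsotropic
    (LemD1OfPlace.standingData L v (IsCMField.complexConj L) 2 (Matrix.diagonal dV) (complexConj_imagUnit L) (imagUnit_ne_zero L)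
      le_rfl hJh₀ hJdet₀)} with hTdef
  have hTfin : T.Finite :=
    LemD1OfPlace.finite_setOf_not_isIsotropic L (IsCMField.complexConj L) (complexConj_imagUnit L) (imagUnit_ne_zero L) t hJ
      hJh₀ hJdet₀ hd ht
  have hns : ∀ v ∈ T, ¬ IsSquare (algebraMap (maximalRealSubfield L) (v.adicCompletion (maximalRealSubfield L)) (imagUnitSq L)) :=
    fun v hv => RemD5.not_isSquare_of_not_isIsotropic L v (IsCMField.complexConj L) (complexConj_imagUnit L) (imagUnit_ne_zero L)
      t hJ hJh₀ hJdet₀ hd ht hv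
  -- the flipped trivial collection `ρ`: `ρ_v = 1` off `T`, `ρ_v ≠ 1` on `T`
  obtain ⟨ρ, hoff, hon⟩ := RemD5.exists_eps_flip (imagUnitSq L) (1 : Eps (maximalRealSubfield L) (imagUnitSq L)) T hns
  -- (2) realise `ρ` by a global `θ` (71:19 with the real signs of the totally real `L⁺` as parity valve)
  have hsupp : {v : HeightOneSpectrum (𝓞 (maximalRealSubfield L)) | ρ v ≠ 1}.Finite :=
    hTfin.subset fun v hv => by
      by_contra hvT
      exact hv ((hoff v hvT).trans (Pi.one_apply v))
  have hd0 : imagUnitSq L ≠ 0 := ne_zero_of_coe_eq_mul_self (imagUnit_ne_zero L) hd.symm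
  have hdneg : ∀ (w : InfinitePlace (maximalRealSubfield L)) (hw : w.IsReal),
      InfinitePlace.embedding_of_isReal hw (imagUnitSq L) < 0 :=
    fun w hw => embedding_of_isReal_lt_zero_of_coe_eq_mul_self (complexConj_imagUnit L) (imagUnit_ne_zero L) hd.symm w hw
  obtain ⟨w₀⟩ : Nonempty (InfinitePlace (maximalRealSubfield L)) := inferInstance
  obtain ⟨θ, hθ⟩ := Literature.NumberTheory.QuadraticForms.exists_prescribed_normClass_of_finite (maximalRealSubfield L)
    (imagUnitSq L) hd0 hdneg w₀ (IsTotallyReal.isReal w₀) ρ hsupp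
  -- (3) `a′ := a · θ`
  refine ⟨a * θ, fun hJh hJdet v => ?_⟩
  have hθv : locF (↥(maximalRealSubfield L)) (imagUnitSq L) θ v = ρ v := by
    rw [locF_apply]; exact hθ v
  -- `x · ρ_v = x ↔ ρ_v = 1` in the local norm-class group
  have key : locF (↥(maximalRealSubfield L)) (imagUnitSq L) a v * ρ v = locF (↥(maximalRealSubfield L)) (imagUnitSq L) a v ↔
      ρ v = 1 :=
    ⟨fun h => by
      simpa only [inv_mul_cancel_left, inv_mul_cancel] using
        congrArg (fun y => (locF (↥(maximalRealSubfield L)) (imagUnitSq L) a v)⁻¹ * y) h,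
     fun h => by rw [h]; exact mul_one (locF (↥(maximalRealSubfield L)) (imagUnitSq L) a v)⟩
  rw [map_mul, Pi.mul_apply, hθv, key]
  by_cases hv : v ∈ T
  · exact iff_of_false (hon v hv) (by simpa [hTdef] using hv)
  · exact iff_of_true (hoff v hv) (by simpa [hTdef] using hv)

end Summit.HodgeConjecture.HodgeConjecture.Cruxes.HLiu418.F0P5PaydownStubRelabelUnit

end
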